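import Summits.MatrixMultiplication.OmegaCensus.HeisenbergClassification

/-!
# ω-census, family (b3): conjecture C9 — Rédei's minimal non-abelian `p`-groups of type `N` map onto `Heis p`

HONEST FRAMING (pub-omega census; verbatim): lottery ticket; floor = certified bounds/negative ranges.
Census BOOKKEEPING (conjecture C9 of the cell; pub-omega stpp-1 gen 19).  Rédei (1947) classified the MINIMAL NON-ABELIAN
`p`-groups (every proper subgroup abelian): `Q₈`; the metacyclic `M_p(m,n) = ⟨a,b | a^{p^m} = b^{p^n} = 1, a^b = a^{1+p^{m-1}}⟩`
(`m ≥ 2`); and `N_p(m,n) = ⟨a,b | a^{p^m} = b^{p^n} = c^p = 1, [a,b] = c, c central⟩` (`N_p(1,1) = He_p`).  Every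
non-abelian finite `p`-group contains a minimal non-abelian subgroup, and box-uselessness passes to overgroups and to groups
mapping onto a useless one (C9 (a): `not_boxUseful_of_injective`, `not_boxUseful_of_surjective`).  This file gives the type-`N`
branch in the kernel: a computable model `RedeiN p M N` — the central extension of `ℤ/M × ℤ/N` by `ℤ/p` with cocycle
`(b mod p)·(a' mod p)`, for ANY moduli `M, N` divisible by `p` (for `M = p^m`, `N = p^n` this is `N_p(m,n)`: `a = (1,0,0)` has
order `p^m`, `b = (0,1,0)` order `p^n`, `[a,b] = (0,0,∓1)` central of order `p`) — with PROVED group axioms, the surjection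
`RedeiN.toHeis : RedeiN p M N →* Heis p`, `(a,b,c) ↦ ⟨b mod p, a mod p, c⟩`, and hence (`HeisenbergClassification`)
**`not_boxUseful_redeiN : 3 ≤ p → ¬ BoxUseful (RedeiN p M N)`**.  CONSEQUENCE FOR C9 (b) (desk remark, not a kernel statement):
for odd `p`, C9 (b) on ALL finite `p`-groups reduces to the metacyclic family `M_p(m,n)`, indeed to its quotients
`M_p(m,1) = ℤ/p^m ⋊ ℤ/p` (`m ≥ 2`; centre index `p²`) — OPEN here, not claimed.  Nothing here is progress on `ω`.
-/

namespace Summit.MatrixMultiplication.OmegaCensus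

open Finset ProductBoxBound

/-- Rédei-type central extension: `(a, b, c) ∈ ℤ/M × ℤ/N × ℤ/p` with
`(a,b,c)(a',b',c') = (a+a', b+b', c+c'+(b mod p)(a' mod p))`. [folklore] -/
structure RedeiN (p M N : ℕ) where
  /-- exponent of `a` -/
  a : ZMod M
  /-- exponent of `b` -/
  b : ZMod N
  /-- exponent of the central commutator `c` -/
  c : ZMod p
  deriving DecidableEq

namespace RedeiN

variable {p M N : ℕ}

/-- Two elements agree iff all coordinates agree. [folklore] -/
@[ext] theorem ext {x y : RedeiN p M N} (ha : x.a = y.a) (hb : x.b = y.b) (hc : x.c = y.c) : x = y := by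
  cases x; cases y; congr

/-- `RedeiN p M N ≃ ℤ/M × ℤ/N × ℤ/p` as types. [folklore] -/
def equivProd : RedeiN p M N ≃ ZMod M × ZMod N × ZMod p :=
  ⟨fun x => (x.a, x.b, x.c), fun q => ⟨q.1, q.2.1, q.2.2⟩, fun _ => rfl, fun _ => rfl⟩

/-- Finite, through `equivProd`. [folklore] -/
instance [NeZero M] [NeZero N] [NeZero p] : Fintype (RedeiN p M N) := Fintype.ofEquiv _ equivProd.symm

/-- `|RedeiN p M N| = M·N·p`. [folklore] -/
theorem card [NeZero M] [NeZero N] [NeZero p] : Fintype.card (RedeiN p M N) = M * (N * p) := by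
  rw [Fintype.ofEquiv_card, Fintype.card_prod, Fintype.card_prod, ZMod.card, ZMod.card, ZMod.card]

section GroupStructure

variable [Fact (p ∣ M)] [Fact (p ∣ N)]

/-- Reduction `ℤ/M → ℤ/p`. [folklore] -/
def piM : ZMod M →+* ZMod p := ZMod.castHom (Fact.out : p ∣ M) (ZMod p)

/-- Reduction `ℤ/N → ℤ/p`. [folklore] -/
def piN : ZMod N →+* ZMod p := ZMod.castHom (Fact.out : p ∣ N) (ZMod p)

/-- Product with cocycle `(b mod p)(a' mod p)`. [folklore] -/
instance : Mul (RedeiN p M N) :=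
  ⟨fun x y => ⟨x.a + y.a, x.b + y.b, x.c + y.c + piN (p := p) x.b * piM (p := p) y.a⟩⟩
/-- Identity. [folklore] -/
instance : One (RedeiN p M N) := ⟨⟨0, 0, 0⟩⟩
/-- Inverse `(a,b,c)⁻¹ = (−a, −b, −c + (b mod p)(a mod p))`. [folklore] -/
instance : Inv (RedeiN p M N) := ⟨fun x => ⟨-x.a, -x.b, -x.c + piN (p := p) x.b * piM (p := p) x.a⟩⟩

/-- The multiplication rule, unfolded. [folklore] -/
theorem mul_def (x y : RedeiN p M N) :
    x * y = ⟨x.a + y.a, x.b + y.b, x.c + y.c + piN (p := p) x.b * piM (p := p) y.a⟩ := rfl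
omit [Fact (p ∣ M)] [Fact (p ∣ N)] in
/-- The identity, unfolded. [folklore] -/
theorem one_def : (1 : RedeiN p M N) = ⟨0, 0, 0⟩ := rfl
/-- The inverse, unfolded. [folklore] -/
theorem inv_def (x : RedeiN p M N) : x⁻¹ = ⟨-x.a, -x.b, -x.c + piN (p := p) x.b * piM (p := p) x.a⟩ := rfl

/-- `RedeiN p M N` is a group (axioms by `ring` after `map_add`). [folklore] -/
instance : Group (RedeiN p M N) :=
  Group.ofLeftAxioms
    (fun x y z => by apply ext <;> simp only [mul_def, map_add] <;> ring)
    (fun x => by apply ext <;> simp only [mul_def, one_def, map_zero] <;> ring)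
    (fun x => by apply ext <;> simp only [mul_def, inv_def, one_def, map_neg] <;> ring)

/-- The generators do not commute: `(1,0,0)(0,1,0) ≠ (0,1,0)(1,0,0)` once `p ≥ 2`. [folklore] -/
theorem gen_not_comm (h2 : 2 ≤ p) :
    (⟨1, 0, 0⟩ : RedeiN p M N) * ⟨0, 1, 0⟩ ≠ ⟨0, 1, 0⟩ * ⟨1, 0, 0⟩ := by
  haveI : Fact (1 < p) := ⟨by omega⟩
  intro h
  have hc := congrArg RedeiN.c h
  simp only [mul_def, map_zero, map_one, mul_zero, mul_one, add_zero, zero_add] at hc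
  exact zero_ne_one hc

/-- **The surjection onto the Heisenberg group**: `(a, b, c) ↦ ⟨b mod p, a mod p, c⟩`. [folklore] -/
def toHeis : RedeiN p M N →* Heis p where
  toFun x := ⟨piN (p := p) x.b, piM (p := p) x.a, x.c⟩
  map_one' := by apply Heis.ext <;> simp only [one_def, map_zero, Heis.one_def]
  map_mul' x y := by apply Heis.ext <;> simp only [mul_def, map_add, Heis.mul_def]

/-- `toHeis` is surjective. [folklore] -/
theorem toHeis_surjective : Function.Surjective (toHeis (p := p) (M := M) (N := N)) := by
  intro y
  obtain ⟨a, ha⟩ := ZMod.ringHom_surjective (piM (p := p) (M := M)) y.b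
  obtain ⟨b, hb⟩ := ZMod.ringHom_surjective (piN (p := p) (N := N)) y.a
  exact ⟨⟨a, b, y.c⟩, Heis.ext hb ha rfl⟩

/-- **Rédei type-`N` groups are not box-useful** (`p ≥ 3`; any moduli `M, N` divisible by `p`): they map onto `Heis p`. [folklore] -/
theorem not_boxUseful_redeiN [NeZero M] [NeZero N] [NeZero p] (h3 : 3 ≤ p) : ¬ BoxUseful (RedeiN p M N) :=
  Heis.not_boxUseful_of_surjective_heis' h3 toHeis toHeis_surjective

/-- No finite group mapping onto some `RedeiN p M N` (`p ≥ 3`) is box-useful. [folklore] -/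
theorem not_boxUseful_of_surjective_redeiN [NeZero M] [NeZero N] [NeZero p] (h3 : 3 ≤ p) {G : Type*} [Group G]
    [Fintype G] [DecidableEq G] (f : G →* RedeiN p M N) (hf : Function.Surjective f) : ¬ BoxUseful G :=
  Heis.not_boxUseful_of_surjective_heis' h3 (toHeis.comp f) (toHeis_surjective.comp hf)

end GroupStructure

end RedeiN

/-- `p ∣ p^m` for `m ≠ 0`, as a `Fact` instance for `RedeiN p (p^m) (p^n)`. [folklore] -/
instance fact_dvd_pow_self (p m : ℕ) [NeZero m] : Fact (p ∣ p ^ m) := ⟨dvd_pow_self p (NeZero.ne m)⟩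

/-- **`N_p(m,n) = RedeiN p (p^m) (p^n)` (`m, n ≥ 1`) is not box-useful for `p ≥ 3`.** [folklore] -/
theorem RedeiN.not_boxUseful_pow {p m n : ℕ} [NeZero p] [NeZero m] [NeZero n] (h3 : 3 ≤ p) :
    ¬ BoxUseful (RedeiN p (p ^ m) (p ^ n)) :=
  RedeiN.not_boxUseful_redeiN h3

end Summit.MatrixMultiplication.OmegaCensus
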